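import Summits.QuantumAdvantage.QuantumAdvantage.Theorems.CubicForrelationSignedExactCubicForrelationNotPrBPPStubPolarGeometry
import Summits.QuantumAdvantage.QuantumAdvantage.Theorems.CubicForrelationSignedExactCubicForrelationNotPrBPPStubDualShape
import Summits.QuantumAdvantage.QuantumAdvantage.Theorems.CubicForrelationSignedExactCubicForrelationInPrBPPDescentGoodPairs

/-!
# Item `CubicForrelation.SignedExactCubicForrelationInPrBPP` (stmt-QuantumAdvantage-14671): SEED COVERAGE

Support lemmas (routine seat c6, 2026-08-16) for the refutation-direction item stmt-QuantumAdvantage-14671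
(= `¬` crux r3 `SignedExactCubicForrelationNotPrBPP`, stmt-QuantumAdvantage-13932). The one open statement of the
r3 line `dual-pingpong-frame` (GROW reshape) is the randomised SEED SUPPLY `stub_kernelStats`: from a closed orthogonal
pair `(S, U)` a uniformly random probe `w` must, with noticeable probability, leak a NEW frame vector, i.e. the frame part
`V ∩ rad M^g_w` of its polar radical must not lie inside the part `S` of the frame already found. For a
Maiorana–McFarland-shaped `g(y', y'') = y'·π(y'') ⊕ h(y'')` the frame part of the radical of the probe `w = (w', w'')`
is `{(u', 0) : u' ⊥ im B_π(w'', ·)}` (landed `stub_polarGeometry` (A)/(B): `D_w D_{(u',0)} D_v g ≡ u'·B_π(w'', v'')`),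
so the question is which frame vectors `u'` are orthogonal to the image of SOME polar map `B_π(w'', ·)`, `w'' ≠ 0`.
This file answers it completely when `π` is a BIJECTION (the exact-pair situation, `stub_dualShape`):

* `bracket_ne_of_bijective` — degree-free: for ANY bijection `π` of `𝔽₂^m` and any `η ≠ 0` some `t ≠ 0` has
  `B_π(t, z) ≠ η` for all `z` (`t := π⁻¹(η ⊕ π 0)`: `B_π(t,z) = π t ⊕ π 0` would give `π(t ⊕ z) = π z`). No non-zero
  vector lies in every polar image `im B_π(t, ·)`, `t ≠ 0`; dually (for quadratic `π`, where the image is a subspace) the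
  leaked frame parts `(im B_π(t,·))^⊥ × 0` are contained in no hyperplane of the frame.
* `toZFun_component_mem_lowDeg`, `sum_signOf_component_eq_zero` — every component `u'·π` (`u' ≠ 0`) of a
  coordinatewise-quadratic bijection is a BALANCED QUADRATIC (reindex the character sum `∑_x (-1)^{u'·x} = 0` by `π`).
* `exists_radical_antiperiod` — hence (landed `Descent.exists_antiperiod_of_quadratic_balanced`, Dickson) it has an
  anti-period `d ≠ 0`: `u'·B_π(d, z) = 0` for all `z` (`d` in the radical of the polar form of `u'·π`) and
  `u'·π(d) ≠ u'·π(0)`.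
* `frame_vector_leaked` — **SEED COVERAGE**: for `g` MM-shaped over a coordinatewise-quadratic bijection `π` (any `h`),
  EVERY non-zero frame vector `(u', 0)` lies in the polar radical `rad M^g_w` of every probe `w = (w', d)` with second half
  this `d ≠ 0` — `D_w D_{(u',0)} D_v g ≡ 0` — and the offset bit is `g(0,0) ⊕ g(u',0) ⊕ g(0,d) ⊕ g(u',d) = 1`. (The landed
  seed leak `stub_polarGeometry` (B) is the converse quantifier order: every probe leaks SOME frame vector.)
* `exists_leak_not_mem` — consequently, for every proper subset `S ∋ 0` of the frame coordinates there are a frame vector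
  `u' ∉ S` and a probe direction `d ≠ 0` leaking it: the b-side GROW step is never starved of probes for lack of leaked
  frame vectors outside `S` (what remains for `stub_kernelStats` is the junk/probability count, not existence).

Vocabulary: inner products spelled `(univ.filter fun i => uᵢ ∧ zᵢ).card.bodd`, brackets
`π(v ⊕ w) ⊕ π(v) ⊕ π(w) ⊕ π(0)`, third derivatives written out, exactly as in the landed stub files; no definitions.
References: C. Carlet, *Boolean Functions for Cryptography and Coding Theory*, CUP 2020, §5.2 (quadratic functions:
balancedness and the kernel of the polar form), Prop. 54 (Dillon's criterion / M-subspaces) [Carlet2020];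
F. J. MacWilliams, N. J. A. Sloane, *The Theory of Error-Correcting Codes* (1977), Ch. 15 §2 (Dickson) [MacWilliamsSloane1977];
R. O'Donnell, *Analysis of Boolean Functions*, CUP 2014, §1.4 (orthogonality of characters) [ODonnell2014].
-/

noncomputable section

set_option linter.dupNamespace false -- D-0017: single-problem summit ⇒ `QuantumAdvantage.QuantumAdvantage` by design

namespace Summit.QuantumAdvantage.QuantumAdvantage.Theorems.SignedExactCubicForrelationInPrBPP.SeedCoverage

open Finset
open Literature.Computability.Complexity Literature.Computability.QuantumComplexity
open Literature.Computability.QuantumComplexity.BuzetChailloux (bxor zeroVec bxor_self bxor_comm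
  bxor_zeroVec zeroVec_bxor)
open Literature.Computability.Complexity.LowDegree (xorVec)
open Literature.Computability.Complexity.BLR (toZ toZ_xor toZ_injective)
open Summit.QuantumAdvantage.QuantumAdvantage.Theorems.SignedExactCubicForrelationNotPrBPP (signOf_card_bodd)
open Summit.QuantumAdvantage.QuantumAdvantage.Theorems.SignedExactCubicForrelationNotPrBPP.PolarGeometry
  (bdot_bracket toZ_bdot d3_seed_eq exists_append xor_frame_eq twist_eq_one_iff_bdot bdot_comm)

variable {m : ℕ}

/-! ### The leak escapes every hyperplane (any bijection, no degree hypothesis) -/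

/-- **No non-zero vector is a universal polar value.** For a bijection `π` of `𝔽₂^m` and `η ≠ 0` there is `t ≠ 0`
such that `B_π(t, z) = π(t ⊕ z) ⊕ π(t) ⊕ π(z) ⊕ π(0) ≠ η` for every `z`: take `t` with `π(t) ⊕ π(0) = η`; then
`B_π(t, z) = η` would force `π(t ⊕ z) = π(z)`, i.e. `t = 0`, i.e. `η = 0`. [folklore] [cite: Carlet2020, §5.2] -/
theorem bracket_ne_of_bijective {π : (Fin m → Bool) → Fin m → Bool} (hπ : Function.Bijective π)
    {η : Fin m → Bool} (hη : η ≠ zeroVec) :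
    ∃ t : Fin m → Bool, t ≠ zeroVec ∧
      ∀ z : Fin m → Bool, (fun i => (π (bxor t z) i ^^ π t i ^^ π z i ^^ π zeroVec i)) ≠ η := by
  obtain ⟨t, ht⟩ := hπ.2 (bxor η (π zeroVec))
  have ht' : ∀ i, π t i = (η i ^^ π zeroVec i) := fun i => congrFun ht i
  have ht0 : t ≠ zeroVec := by
    rintro rfl
    apply hη
    funext i
    have key : ∀ P E : Bool, P = (E ^^ P) → E = false := by decide
    exact key _ _ (ht' i)
  refine ⟨t, ht0, fun z hz => ht0 ?_⟩
  have hπz : π (bxor t z) = π z := by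
    funext i
    have h1 : (π (bxor t z) i ^^ π t i ^^ π z i ^^ π zeroVec i) = η i := congrFun hz i
    have key : ∀ A B C D E : Bool, (A ^^ B ^^ C ^^ D) = E → B = (E ^^ D) → A = C := by decide
    exact key _ _ _ _ _ h1 (ht' i)
  have htz : bxor t z = z := hπ.1 hπz
  funext i
  have h2 : (t i ^^ z i) = z i := congrFun htz i
  have key : ∀ T Z : Bool, (T ^^ Z) = Z → T = false := by decide
  exact key _ _ h2

/-! ### Components of a quadratic bijection are balanced quadratics -/

/-- `xorVec` (of `LowDegree`) and `bxor` (of `BuzetChailloux`) are the same operation. [folklore] -/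
theorem xorVec_eq_bxor (x d : Fin m → Bool) : xorVec x d = bxor x d := by
  funext i
  show xor (x i) (d i) = (x i ^^ d i)
  cases x i <;> cases d i <;> rfl

/-- **Components of a coordinatewise-quadratic map are quadratic**: `y ↦ u·π(y)` reads in `lowDeg m 2`
(it is the sum over `i` with `uᵢ = 1` of the coordinates `[πᵢ]`, each in `lowDeg m 2`, which is additively closed).
[cite: Carlet2020, §5.2] -/
theorem toZFun_component_mem_lowDeg {π : (Fin m → Bool) → Fin m → Bool}
    (hπ : ∀ i, IsDegLeFun 2 fun y => π y i) (u : Fin m → Bool) :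
    QuadPolar.toZFun (fun y => (univ.filter fun i => u i && π y i).card.bodd) ∈ CHHL2018.lowDeg m 2 := by
  have e : QuadPolar.toZFun (fun y => (univ.filter fun i => u i && π y i).card.bodd) =
      ∑ i ∈ univ.filter (fun i => u i = true), QuadPolar.toZFun (fun y => π y i) := by
    funext y
    rw [QuadPolar.toZFun_apply, toZ_bdot, Finset.sum_apply, Finset.sum_filter]
    refine sum_congr rfl fun i _ => ?_
    show toZ (u i && π y i) = if u i = true then toZ (π y i) else 0
    cases u i <;> cases π y i <;> rfl
  rw [e]
  refine Finset.sum_induction _ (fun G => G ∈ CHHL2018.lowDeg m 2)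
    (fun a b ha hb => CHHL2018.add_mem_lowDeg 2 ha hb) (CHHL2018.zero_mem_lowDeg 2) fun i _ => ?_
  obtain ⟨p, hp, hfp⟩ := hπ i
  exact QuadPolar.toZFun_mem_lowDeg_of_poly p hp hfp

/-- **Components of a bijection are balanced**: for a bijection `π` of `𝔽₂^m` and `u ≠ 0`,
`∑_y (-1)^{u·π(y)} = ∑_x (-1)^{u·x} = 0` (reindex by `π`, orthogonality of characters). [cite: ODonnell2014, §1.4] -/
theorem sum_signOf_component_eq_zero {π : (Fin m → Bool) → Fin m → Bool} (hπ : Function.Bijective π)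
    {u : Fin m → Bool} (hu : u ≠ zeroVec) :
    ∑ y, signOf ((univ.filter fun i => u i && π y i).card.bodd) = 0 := by
  have e := Equiv.sum_comp (Equiv.ofBijective π hπ)
    (fun x => signOf ((univ.filter fun i => u i && x i).card.bodd))
  simp only [Equiv.ofBijective_apply] at e
  rw [e]
  simp_rw [signOf_card_bodd]
  rw [Simon.sum_twist, if_neg (show ¬ u = (fun _ => false) from hu)]

/-- **A radical anti-period for every component.** For a coordinatewise-quadratic bijection `π` of `𝔽₂^m` and `u ≠ 0`
there is `d ≠ 0` with `u·B_π(d, z) = 0` for all `z` (`d` lies in the radical of the polar form of the component `u·π`)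
and `u·π(d) ≠ u·π(0)` (`d` is an anti-period: `u·π(x ⊕ d) = u·π(x) ⊕ 1`). The component is a balanced quadratic, and a
balanced quadratic has an anti-period in its radical (`Descent.exists_antiperiod_of_quadratic_balanced`); an anti-period is
automatically a radical direction. [cite: Carlet2020, §5.2] [cite: MacWilliamsSloane1977, Ch. 15 §2] -/
theorem exists_radical_antiperiod {π : (Fin m → Bool) → Fin m → Bool} (hbij : Function.Bijective π)
    (hπ : ∀ i, IsDegLeFun 2 fun y => π y i) {u : Fin m → Bool} (hu : u ≠ zeroVec) :
    ∃ d : Fin m → Bool, d ≠ zeroVec ∧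
      (∀ z : Fin m → Bool,
        (univ.filter fun i => u i && (π (bxor d z) i ^^ π d i ^^ π z i ^^ π zeroVec i)).card.bodd = false) ∧
      ((univ.filter fun i => u i && π d i).card.bodd ^^ (univ.filter fun i => u i && π zeroVec i).card.bodd) = true := by
  obtain ⟨d, -, hd⟩ := Descent.exists_antiperiod_of_quadratic_balanced
    (q := fun y => (univ.filter fun i => u i && π y i).card.bodd)
    (toZFun_component_mem_lowDeg hπ u) (sum_signOf_component_eq_zero hbij hu)
  have hd' : ∀ x : Fin m → Bool, ((univ.filter fun i => u i && π x i).card.bodd ^^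
      (univ.filter fun i => u i && π (bxor x d) i).card.bodd) = true := fun x => by
    have := hd x
    rwa [xorVec_eq_bxor] at this
  have h0 : ((univ.filter fun i => u i && π zeroVec i).card.bodd ^^
      (univ.filter fun i => u i && π d i).card.bodd) = true := by
    have := hd' zeroVec
    rwa [zeroVec_bxor] at this
  refine ⟨d, ?_, fun z => ?_, ?_⟩
  · rintro rfl
    have := hd' zeroVec
    rw [bxor_zeroVec, Bool.xor_self] at this
    exact Bool.false_ne_true this
  · have hb := bdot_bracket hπ u zeroVec d z
    rw [zeroVec_bxor, zeroVec_bxor] at hb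
    rw [← hb]
    have key : ∀ A B C D : Bool, (A ^^ B) = true → (C ^^ D) = true → ((A ^^ B) ^^ (C ^^ D)) = false := by decide
    exact key _ _ _ _ h0 (hd' z)
  · have key : ∀ A B : Bool, (A ^^ B) = true → (B ^^ A) = true := by decide
    exact key _ _ h0

/-! ### Seed coverage for Maiorana–McFarland-shaped functions -/

/-- **SEED COVERAGE.** Let `g(y', y'') = y'·π(y'') ⊕ h(y'')` on `𝔽₂^{m+m}` with `π` a coordinatewise-quadratic BIJECTION
(`h` arbitrary). For every frame vector `(u', 0)`, `u' ≠ 0`, there is a probe direction `d ≠ 0` such that for EVERY probe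
`w = (w', d)` all third derivatives `D_w D_{(u',0)} D_v g` vanish — `(u', 0)` lies in the polar radical `rad M^g_w`, i.e. it is
one of the frame vectors leaked by `w` — and the offset bit `g(0,0) ⊕ g(u',0) ⊕ g(0,d) ⊕ g(u',d)` equals `1`. Proof:
`D_w D_{(u',0)} D_v g ≡ u'·B_π(d, v'')` (landed `d3_seed_eq`) and `exists_radical_antiperiod`. So over all probes the
leaked frame vectors COVER the frame `V = {y'' = 0}` (the landed seed leak, `stub_polarGeometry` (B), is the converse
order of quantifiers: every probe leaks some frame vector). [cite: Carlet2020, Prop. 54] [cite: Carlet2020, §5.2] -/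
theorem frame_vector_leaked {g : (Fin (m + m) → Bool) → Bool} {π : (Fin m → Bool) → Fin m → Bool}
    {h : (Fin m → Bool) → Bool}
    (hg : ∀ y' y'' : Fin m → Bool,
      g (Fin.append y' y'') = ((Finset.univ.filter fun i => y' i && (π y'') i).card.bodd ^^ h y''))
    (hbij : Function.Bijective π) (hπ : ∀ i, IsDegLeFun 2 fun y => π y i)
    {u' : Fin m → Bool} (hu' : u' ≠ zeroVec) :
    ∃ d : Fin m → Bool, d ≠ zeroVec ∧
      (∀ (w' : Fin m → Bool) (v x : Fin (m + m) → Bool),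
        ((g x ^^ g (bxor x (Fin.append w' d)) ^^ g (bxor x (Fin.append u' zeroVec)) ^^
              g (bxor x (bxor (Fin.append w' d) (Fin.append u' zeroVec)))) ^^
            (g (bxor x v) ^^ g (bxor (bxor x v) (Fin.append w' d)) ^^ g (bxor (bxor x v) (Fin.append u' zeroVec)) ^^
              g (bxor (bxor x v) (bxor (Fin.append w' d) (Fin.append u' zeroVec))))) = false) ∧
      (g (Fin.append zeroVec zeroVec) ^^ g (Fin.append u' zeroVec) ^^ g (Fin.append zeroVec d) ^^
          g (Fin.append u' d)) = true := by
  obtain ⟨d, hd0, hrad, hoff⟩ := exists_radical_antiperiod hbij hπ hu'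
  refine ⟨d, hd0, fun w' v x => ?_, ?_⟩
  · obtain ⟨v', v'', rfl⟩ := exists_append v
    obtain ⟨x', x'', rfl⟩ := exists_append x
    rw [d3_seed_eq hg hπ u' w' d v' v'' x' x'']
    exact hrad v''
  · have h1 := xor_frame_eq hg u' zeroVec zeroVec
    have h2 := xor_frame_eq hg u' zeroVec d
    rw [zeroVec_bxor] at h1 h2
    have key : ∀ A B C D P Q : Bool, (A ^^ B) = Q → (C ^^ D) = P → (P ^^ Q) = true →
        (A ^^ B ^^ C ^^ D) = true := by decide
    exact key _ _ _ _ _ _ h1 h2 hoff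

/-- **The GROW step is never starved of leaked frame vectors.** In the situation of `frame_vector_leaked`, for every
set `S ∋ 0` of frame coordinates other than all of `𝔽₂^m` (the frame part of the closed pair found so far) there are a
frame coordinate `u' ∉ S` and a probe direction `d ≠ 0` such that every probe `(w', d)` leaks `(u', 0)`.
[cite: Carlet2020, Prop. 54] -/
theorem exists_leak_not_mem {g : (Fin (m + m) → Bool) → Bool} {π : (Fin m → Bool) → Fin m → Bool}
    {h : (Fin m → Bool) → Bool}
    (hg : ∀ y' y'' : Fin m → Bool,
      g (Fin.append y' y'') = ((Finset.univ.filter fun i => y' i && (π y'') i).card.bodd ^^ h y''))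
    (hbij : Function.Bijective π) (hπ : ∀ i, IsDegLeFun 2 fun y => π y i)
    {S : Finset (Fin m → Bool)} (h0 : zeroVec ∈ S) (hS : S ≠ univ) :
    ∃ u' : Fin m → Bool, u' ∉ S ∧ ∃ d : Fin m → Bool, d ≠ zeroVec ∧
      ∀ (w' : Fin m → Bool) (v x : Fin (m + m) → Bool),
        ((g x ^^ g (bxor x (Fin.append w' d)) ^^ g (bxor x (Fin.append u' zeroVec)) ^^
              g (bxor x (bxor (Fin.append w' d) (Fin.append u' zeroVec)))) ^^
            (g (bxor x v) ^^ g (bxor (bxor x v) (Fin.append w' d)) ^^ g (bxor (bxor x v) (Fin.append u' zeroVec)) ^^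
              g (bxor (bxor x v) (bxor (Fin.append w' d) (Fin.append u' zeroVec))))) = false := by
  obtain ⟨u', -, hu'⟩ := exists_of_ssubset (ssubset_univ_iff.2 hS)
  have hne : u' ≠ zeroVec := fun h => hu' (h ▸ h0)
  obtain ⟨d, hd0, hrad, -⟩ := frame_vector_leaked hg hbij hπ hne
  exact ⟨u', hu', d, hd0, hrad⟩


/-! ### How many (probe direction, leaked frame vector) incidences escape a hyperplane -/

/-- Exactly half of `𝔽₂^m` pairs oddly with a non-zero `η`: `2 · #{u : u·η = 1} = 2^m` (the other half is the
orthogonal of the subspace `{0, η}`, of index `2` by `|U|·|U^⊥| = 2^m`). [cite: ODonnell2014, §1.4] -/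
theorem two_mul_card_bdot_eq_true {η : Fin m → Bool} (hη : η ≠ zeroVec) :
    2 * (univ.filter fun u : Fin m → Bool => (univ.filter fun i => u i && η i).card.bodd = true).card = 2 ^ m := by
  -- the even half is the character-orthogonal of `{0, η}`
  have h0 : zeroVec ∈ ({zeroVec, η} : Finset (Fin m → Bool)) := mem_insert_self _ _
  have hadd : ∀ x ∈ ({zeroVec, η} : Finset (Fin m → Bool)), ∀ y ∈ ({zeroVec, η} : Finset (Fin m → Bool)),
      bxor x y ∈ ({zeroVec, η} : Finset (Fin m → Bool)) := by
    intro x hx y hy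
    simp only [mem_insert, mem_singleton] at hx hy ⊢
    rcases hx with rfl | rfl <;> rcases hy with rfl | rfl <;> simp [bxor_self]
  have hperp := DerivativeWalsh.card_mul_card_perp h0 hadd
  have hU : ({zeroVec, η} : Finset (Fin m → Bool)).card = 2 := card_pair (Ne.symm hη)
  have hB : (univ.filter fun y : Fin m → Bool => ∀ x ∈ ({zeroVec, η} : Finset (Fin m → Bool)), twist x y = 1) =
      univ.filter fun u : Fin m → Bool => ¬ ((univ.filter fun i => u i && η i).card.bodd = true) := by
    refine filter_congr fun u _ => ?_
    simp only [mem_insert, mem_singleton, forall_eq_or_imp, forall_eq, Bool.not_eq_true]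
    rw [twist_eq_one_iff_bdot, twist_eq_one_iff_bdot, bdot_comm η u]
    constructor
    · exact fun h => h.2
    · intro h
      refine ⟨?_, h⟩
      have : (univ.filter fun i => (zeroVec : Fin m → Bool) i && u i) = ∅ :=
        filter_eq_empty_iff.2 fun i _ => by simp [zeroVec]
      rw [this, card_empty, Nat.bodd_zero]
  rw [hU, hB] at hperp
  have hnat : 2 * (univ.filter fun u : Fin m → Bool =>
      ¬ ((univ.filter fun i => u i && η i).card.bodd = true)).card = 2 ^ m := by exact_mod_cast hperp
  have hsplit := Finset.card_filter_add_card_filter_not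
    (s := (univ : Finset (Fin m → Bool))) (fun u : Fin m → Bool => (univ.filter fun i => u i && η i).card.bodd = true)
  rw [card_univ, Fintype.card_fun, Fintype.card_bool, Fintype.card_fin] at hsplit
  omega

/-- **At least `2^{m-1}` incidences escape every hyperplane.** For a coordinatewise-quadratic bijection `π` of `𝔽₂^m`
and `η ≠ 0`, the pairs `(d, u)` with `u·η = 1`, `d ≠ 0` and `u·B_π(d, ·) ≡ 0` (i.e. the frame vector `(u, 0)` is leaked by
the probes of direction `d` and lies OUTSIDE the hyperplane `η^⊥`) number at least `2^{m-1}`: `u ↦ (d_u, u)` with the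
anti-period `d_u` of `exists_radical_antiperiod` is injective on the `2^{m-1}` vectors `u` with `u·η = 1`. Grouping by `d`:
writing `Λ_d = {u : u·B_π(d,·) ≡ 0}` (the frame part of the polar radical of direction `d`, of size `2^{κ(d)}`), the fibre
over `d` is `Λ_d ∖ η^⊥`, empty or of size `2^{κ(d)-1}`, so `∑_{d ≠ 0 : Λ_d ⊄ η^⊥} 2^{κ(d)} ≥ 2^m` — the probe directions whose
leak escapes `η^⊥` carry total radical mass `≥ 2^m` (e.g. at least `2^{m-κ_max}` of the `2^m` directions).
[cite: Carlet2020, §5.2] [cite: ODonnell2014, §1.4] -/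
theorem two_pow_le_two_mul_card_leak_pairs {π : (Fin m → Bool) → Fin m → Bool} (hbij : Function.Bijective π)
    (hπ : ∀ i, IsDegLeFun 2 fun y => π y i) {η : Fin m → Bool} (hη : η ≠ zeroVec) :
    2 ^ m ≤ 2 * ((univ ×ˢ univ).filter fun p : (Fin m → Bool) × (Fin m → Bool) =>
        (univ.filter fun i => p.2 i && η i).card.bodd = true ∧ p.1 ≠ zeroVec ∧
        ∀ z : Fin m → Bool,
          (univ.filter fun i => p.2 i && (π (bxor p.1 z) i ^^ π p.1 i ^^ π z i ^^ π zeroVec i)).card.bodd = false).card := by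
  set A : Finset (Fin m → Bool) :=
    univ.filter fun u : Fin m → Bool => (univ.filter fun i => u i && η i).card.bodd = true with hA
  -- every `u` pairing oddly with `η` is non-zero, hence has a radical anti-period `d_u`
  have hch : ∀ u : Fin m → Bool, u ∈ A → ∃ d : Fin m → Bool, d ≠ zeroVec ∧
      ∀ z : Fin m → Bool,
        (univ.filter fun i => u i && (π (bxor d z) i ^^ π d i ^^ π z i ^^ π zeroVec i)).card.bodd = false := by
    intro u hu
    have hne : u ≠ zeroVec := by
      rintro rfl
      have hmem := (mem_filter.1 hu).2
      have : (univ.filter fun i => (zeroVec : Fin m → Bool) i && η i) = ∅ :=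
        filter_eq_empty_iff.2 fun i _ => by simp [zeroVec]
      rw [this, card_empty, Nat.bodd_zero] at hmem
      exact Bool.false_ne_true hmem
    obtain ⟨d, hd0, hrad, -⟩ := exists_radical_antiperiod hbij hπ hne
    exact ⟨d, hd0, hrad⟩
  choose! dfun hd0 hrad using hch
  have hinj : Set.InjOn (fun u : Fin m → Bool => (dfun u, u)) A := fun u _ u' _ h => (Prod.ext_iff.1 h).2
  have hmaps : ∀ u ∈ A, (dfun u, u) ∈ (univ ×ˢ univ).filter fun p : (Fin m → Bool) × (Fin m → Bool) =>
      (univ.filter fun i => p.2 i && η i).card.bodd = true ∧ p.1 ≠ zeroVec ∧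
      ∀ z : Fin m → Bool,
        (univ.filter fun i => p.2 i && (π (bxor p.1 z) i ^^ π p.1 i ^^ π z i ^^ π zeroVec i)).card.bodd = false := by
    intro u hu
    refine mem_filter.2 ⟨mem_product.2 ⟨mem_univ _, mem_univ _⟩, (mem_filter.1 hu).2, hd0 u hu, hrad u hu⟩
  have hle := card_le_card_of_injOn _ hmaps hinj
  have hAcard := two_mul_card_bdot_eq_true hη
  rw [← hA] at hAcard
  omega

end Summit.QuantumAdvantage.QuantumAdvantage.Theorems.SignedExactCubicForrelationInPrBPP.SeedCoverage

end
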